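import Summits.AtomisticToContinuum.HydrodynamicLimit.Theorems.OneFlightGossipEngineEquilibriumHeatFluxVarianceDecayCorrelations

/-!
# The Green–Kubo inequality and the reduction of C4 to autocorrelation decay (support file 4 for C4)

For the route item `EquilibriumHeatFluxVarianceDecay` (stmt-AtomisticToContinuum-9532, route OneFlightGossipEngine):
* `integral_windowAvg_sq_le_corr`: `E_λ[(w⁻¹∫₀ʷ Y∘Φ_r dr)²] ≤ 2 w⁻¹ ∫₀ʷ |E_λ[Y · Y∘Φ_u]| du` (two Fubinis on
  `(0,w] × λ`, stationarity of two-time correlations, the window estimate of file 3);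
* `succ_mul_lintegral_windowAvg_sq_le_corr`: the same in the `(N+1)`-normalised `ℝ≥0∞` shape of the item;
* `equilibriumHeatFluxVarianceDecay_of_cesaro_corr_decay`: **the item follows from N-uniform Cesàro decay, in
  kinetic time, of the absolute autocorrelation of the per-particle fast heat flux** —
  `lim_{τ→∞} limsup_N (N+1)·w_N⁻¹∫₀^{w_N}|E_{λ^N}[Y · Y∘Φ_u]| du = 0`, `w_N = τ(N+1)^{-1/3}` — which isolates the
  open physical input (decay of equilibrium time correlations of deterministic hard spheres at fixed small density,
  uniformly in `N`; in print only at Boltzmann–Grad scaling). The hypothesis is stated inline (no named fact: it is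
  an open problem, not a published result) and is correctly normalised by file 3.
prover-pitem-stmt-AtomisticToContinuum-9532-0.
-/

noncomputable section

namespace Summit.AtomisticToContinuum.HydrodynamicLimit.Theorems

open MeasureTheory ProbabilityTheory Filter Topology Set
open Literature.Analysis.FluidPDE Literature.MathematicalPhysics.KineticTheory
open scoped InnerProductSpace ENNReal
open BoltzmannGreenKuboOrthMomentum

namespace OneFlightGossipEngineHeatFlux

section GreenKubo

variable {a₀ θ₀ σ : ℝ} {N : ℕ}

/-! ## The Green–Kubo inequality `E_λ[Ȳ²] ≤ 2 w⁻¹ ∫₀ʷ |C(u)| du` -/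

/-- **Inner Fubini**: `|E_λ[(w⁻¹∫₀ʷ Y∘Φ_r dr) · Y∘Φ_s]| ≤ 2 w⁻¹ ∫₀ʷ |C(u)| du` for `s ∈ [0, w]`. [folklore] -/
theorem abs_integral_windowAvg_mul_flow_le (ha : 0 < a₀) (hθ : 0 < θ₀) (hσ : σ ≤ 1 / 2) (N : ℕ)
    (Φ : HardSphereFlow (Torus.geometry (Fin 3)) (hsDiameter σ N) (N + 1))
    {φ : T3 → ℝ} (hφ : Continuous φ) {K : ℝ} (hφK : ∀ y, |φ y| ≤ K) {w : ℝ} (hw : 0 < w) {s : ℝ} (hs : s ∈ Icc 0 w) :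
    |∫ z, (w⁻¹ * ∫ r in (0 : ℝ)..w, 𝐘[N, θ₀, φ, Φ.flow r z]) * 𝐘[N, θ₀, φ, Φ.flow s z]
        ∂(localGibbsLaw σ (fun _ => a₀) (fun _ => 0) (fun _ => θ₀) N Φ)| ≤
      2 * w⁻¹ * ∫ u in (0 : ℝ)..w, |∫ z, 𝐘[N, θ₀, φ, z] * 𝐘[N, θ₀, φ, Φ.flow u z]
        ∂(localGibbsLaw σ (fun _ => a₀) (fun _ => 0) (fun _ => θ₀) N Φ)| := by
  haveI : IsProbabilityMeasure (localGibbsLaw σ (fun _ => a₀) (fun _ => (0 : V3)) (fun _ => θ₀) N Φ) :=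
    isProbabilityMeasure_localGibbsLaw continuous_const continuous_const continuous_const
      (fun _ => ha) (fun _ => hθ) hσ N Φ
  haveI : IsFiniteMeasure (volume.restrict (Ioc (0 : ℝ) w)) := ⟨by simp [Real.volume_Ioc]⟩
  set G := localGibbsLaw σ (fun _ => a₀) (fun _ => (0 : V3)) (fun _ => θ₀) N Φ with hGdef
  set C : ℝ → ℝ := fun u => ∫ z, 𝐘[N, θ₀, φ, z] * 𝐘[N, θ₀, φ, Φ.flow u z] ∂G with hCdef
  -- pull `Y(Φ_s z)` into the window integral
  have e1 : (fun z => (w⁻¹ * ∫ r in (0 : ℝ)..w, 𝐘[N, θ₀, φ, Φ.flow r z]) * 𝐘[N, θ₀, φ, Φ.flow s z]) =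
      fun z => w⁻¹ * ∫ r in (0 : ℝ)..w, 𝐘[N, θ₀, φ, Φ.flow r z] * 𝐘[N, θ₀, φ, Φ.flow s z] := by
    funext z
    rw [mul_assoc, ← intervalIntegral.integral_mul_const]
  -- Fubini on `(0, w] × λ`
  have hint : Integrable (fun p : ℝ × Config (N + 1) (Fin 3) T3 => 𝐘[N, θ₀, φ, Φ.flow p.1 p.2] * 𝐘[N, θ₀, φ, Φ.flow s p.2])
      ((volume.restrict (Ioc (0 : ℝ) w)).prod G) := by
    have hflow := integrable_comp_flow_prod a₀ θ₀ 0 Φ ((measurable_Yobs θ₀ hφ).pow_const 2)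
      (integrable_Yobs_sq ha hθ hσ N Φ hφ hφK) w
    have hflow1 := integrable_comp_flow_prod a₀ θ₀ 0 Φ (measurable_Yobs θ₀ hφ)
      (integrable_Yobs ha hθ hσ N Φ hφ hφK) w
    have hstat : Integrable (fun p : ℝ × Config (N + 1) (Fin 3) T3 => 𝐘[N, θ₀, φ, Φ.flow s p.2] ^ 2)
        ((volume.restrict (Ioc (0 : ℝ) w)).prod G) := by
      simpa using (integrable_const (1 : ℝ)).mul_prod (integrable_Yobs_comp_flow_sq ha hθ hσ N Φ hφ hφK s)
    exact integrable_mul_of_sq_sq hflow1.aestronglyMeasurable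
      (((measurable_Yobs θ₀ hφ).comp ((Φ.measurable_flow s).comp measurable_snd)).aestronglyMeasurable) hflow hstat
  have hint' : Integrable (Function.uncurry fun (z : Config (N + 1) (Fin 3) T3) (r : ℝ) =>
      𝐘[N, θ₀, φ, Φ.flow r z] * 𝐘[N, θ₀, φ, Φ.flow s z]) (G.prod (volume.restrict (Ioc (0 : ℝ) w))) := hint.swap
  have e2 : ∫ z, (∫ r in (0 : ℝ)..w, 𝐘[N, θ₀, φ, Φ.flow r z] * 𝐘[N, θ₀, φ, Φ.flow s z]) ∂G =
      ∫ r in (0 : ℝ)..w, C (|s - r|) := by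
    simp only [intervalIntegral.integral_of_le hw.le]
    rw [integral_integral_swap hint']
    refine setIntegral_congr_fun measurableSet_Ioc fun r _ => ?_
    exact integral_flow_mul_flow_eq_abs ha hθ hσ N Φ hφ r s
  rw [e1, integral_const_mul, e2, abs_mul, abs_of_pos (inv_pos.2 hw), mul_comm (2 : ℝ) w⁻¹, mul_assoc]
  refine mul_le_mul_of_nonneg_left ?_ (inv_nonneg.2 hw.le)
  calc |∫ r in (0 : ℝ)..w, C (|s - r|)| ≤ ∫ r in (0 : ℝ)..w, |C (|s - r|)| :=
        intervalIntegral.abs_integral_le_integral_abs hw.le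
    _ ≤ 2 * ∫ u in (0 : ℝ)..w, |C u| :=
        integral_comp_abs_sub_le (c := fun u => |C u|) (fun u => abs_nonneg _) hs
          (intervalIntegrable_corr ha hθ hσ N Φ hφ hφK hw.le).abs

/-- **GREEN–KUBO INEQUALITY** (every `N`, `w > 0`, flow, `σ ≤ 1/2`): the window variance is controlled by the
Cesàro mean of the absolute autocorrelation, `E_λ[(w⁻¹∫₀ʷ Y∘Φ_r dr)²] ≤ 2 w⁻¹ ∫₀ʷ |E_λ[Y · Y∘Φ_u]| du`. [folklore] -/
theorem integral_windowAvg_sq_le_corr (ha : 0 < a₀) (hθ : 0 < θ₀) (hσ : σ ≤ 1 / 2) (N : ℕ)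
    (Φ : HardSphereFlow (Torus.geometry (Fin 3)) (hsDiameter σ N) (N + 1))
    {φ : T3 → ℝ} (hφ : Continuous φ) {K : ℝ} (hφK : ∀ y, |φ y| ≤ K) {w : ℝ} (hw : 0 < w) :
    ∫ z, (w⁻¹ * ∫ r in (0 : ℝ)..w, 𝐘[N, θ₀, φ, Φ.flow r z]) ^ 2 ∂(localGibbsLaw σ (fun _ => a₀) (fun _ => 0) (fun _ => θ₀) N Φ) ≤
      2 * w⁻¹ * ∫ u in (0 : ℝ)..w, |∫ z, 𝐘[N, θ₀, φ, z] * 𝐘[N, θ₀, φ, Φ.flow u z]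
        ∂(localGibbsLaw σ (fun _ => a₀) (fun _ => 0) (fun _ => θ₀) N Φ)| := by
  haveI : IsProbabilityMeasure (localGibbsLaw σ (fun _ => a₀) (fun _ => (0 : V3)) (fun _ => θ₀) N Φ) :=
    isProbabilityMeasure_localGibbsLaw continuous_const continuous_const continuous_const
      (fun _ => ha) (fun _ => hθ) hσ N Φ
  haveI : IsFiniteMeasure (volume.restrict (Ioc (0 : ℝ) w)) := ⟨by simp [Real.volume_Ioc]⟩
  set G := localGibbsLaw σ (fun _ => a₀) (fun _ => (0 : V3)) (fun _ => θ₀) N Φ with hGdef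
  set A : Config (N + 1) (Fin 3) T3 → ℝ := fun z => w⁻¹ * ∫ r in (0 : ℝ)..w, 𝐘[N, θ₀, φ, Φ.flow r z] with hAdef
  set B : ℝ := 2 * w⁻¹ * ∫ u in (0 : ℝ)..w, |∫ z, 𝐘[N, θ₀, φ, z] * 𝐘[N, θ₀, φ, Φ.flow u z] ∂G| with hBdef
  -- `A ∈ L²(λ)` (Jensen in time, a.e.)
  have hAi : Integrable A G :=
    (integrable_window a₀ θ₀ 0 Φ (measurable_Yobs θ₀ hφ) (integrable_Yobs ha hθ hσ N Φ hφ hφK) hw.le).const_mul _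
  have hA2 : Integrable (fun z => A z ^ 2) G := by
    refine ((integrable_window a₀ θ₀ 0 Φ ((measurable_Yobs θ₀ hφ).pow_const 2)
      (integrable_Yobs_sq ha hθ hσ N Φ hφ hφK) hw.le).const_mul w⁻¹).mono' (hAi.aestronglyMeasurable.pow 2) ?_
    filter_upwards [ae_windowAvg_sq_le ha hθ hσ N Φ hφ hφK hw] with z hz
    rw [Real.norm_eq_abs, abs_of_nonneg (sq_nonneg _)]
    exact hz
  -- `A² = w⁻¹ ∫₀ʷ A · Y∘Φ_s ds` pointwise
  have e1 : ∀ z, A z ^ 2 = w⁻¹ * ∫ s in (0 : ℝ)..w, A z * 𝐘[N, θ₀, φ, Φ.flow s z] := by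
    intro z
    rw [intervalIntegral.integral_const_mul, sq]
    simp only [hAdef]
    ring
  -- Fubini on `(0, w] × λ` for `(s, z) ↦ A z · Y(Φ_s z)`
  have hint : Integrable (fun p : ℝ × Config (N + 1) (Fin 3) T3 => A p.2 * 𝐘[N, θ₀, φ, Φ.flow p.1 p.2])
      ((volume.restrict (Ioc (0 : ℝ) w)).prod G) := by
    have hflow := integrable_comp_flow_prod a₀ θ₀ 0 Φ ((measurable_Yobs θ₀ hφ).pow_const 2)
      (integrable_Yobs_sq ha hθ hσ N Φ hφ hφK) w
    have hflow1 := integrable_comp_flow_prod a₀ θ₀ 0 Φ (measurable_Yobs θ₀ hφ)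
      (integrable_Yobs ha hθ hσ N Φ hφ hφK) w
    have hstat : Integrable (fun p : ℝ × Config (N + 1) (Fin 3) T3 => A p.2 ^ 2)
        ((volume.restrict (Ioc (0 : ℝ) w)).prod G) := by
      simpa using (integrable_const (1 : ℝ)).mul_prod hA2
    have hAm : AEStronglyMeasurable (fun p : ℝ × Config (N + 1) (Fin 3) T3 => A p.2)
        ((volume.restrict (Ioc (0 : ℝ) w)).prod G) := by
      simpa using ((integrable_const (1 : ℝ)).mul_prod hAi).aestronglyMeasurable
    exact integrable_mul_of_sq_sq hAm hflow1.aestronglyMeasurable hstat hflow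
  have hint' : Integrable (Function.uncurry fun (z : Config (N + 1) (Fin 3) T3) (s : ℝ) =>
      A z * 𝐘[N, θ₀, φ, Φ.flow s z]) (G.prod (volume.restrict (Ioc (0 : ℝ) w))) := hint.swap
  have e2 : ∫ z, A z ^ 2 ∂G = w⁻¹ * ∫ s in Ioc (0 : ℝ) w, ∫ z, A z * 𝐘[N, θ₀, φ, Φ.flow s z] ∂G := by
    simp only [e1, intervalIntegral.integral_of_le hw.le]
    rw [integral_const_mul, integral_integral_swap hint']
  -- bound the inner integrals uniformly in `s ∈ (0, w]`
  have hB : ∀ s ∈ Ioc (0 : ℝ) w, ‖∫ z, A z * 𝐘[N, θ₀, φ, Φ.flow s z] ∂G‖ ≤ B := fun s hs => by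
    rw [Real.norm_eq_abs]
    exact abs_integral_windowAvg_mul_flow_le ha hθ hσ N Φ hφ hφK hw ⟨hs.1.le, hs.2⟩
  have hI : ‖∫ s in Ioc (0 : ℝ) w, ∫ z, A z * 𝐘[N, θ₀, φ, Φ.flow s z] ∂G‖ ≤ B * w := by
    have h := norm_setIntegral_le_of_norm_le_const (by simp [Real.volume_Ioc] : volume (Ioc (0 : ℝ) w) < ⊤) hB
    rwa [Real.volume_real_Ioc_of_le hw.le, sub_zero] at h
  have hB0 : 0 ≤ B := by
    have : 0 ≤ ∫ u in (0 : ℝ)..w, |∫ z, 𝐘[N, θ₀, φ, z] * 𝐘[N, θ₀, φ, Φ.flow u z] ∂G| :=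
      intervalIntegral.integral_nonneg hw.le fun u _ => abs_nonneg _
    rw [hBdef]
    positivity
  rw [e2]
  calc w⁻¹ * ∫ s in Ioc (0 : ℝ) w, ∫ z, A z * 𝐘[N, θ₀, φ, Φ.flow s z] ∂G
      ≤ w⁻¹ * ‖∫ s in Ioc (0 : ℝ) w, ∫ z, A z * 𝐘[N, θ₀, φ, Φ.flow s z] ∂G‖ :=
        mul_le_mul_of_nonneg_left (Real.le_norm_self _) (inv_nonneg.2 hw.le)
    _ ≤ w⁻¹ * (B * w) := mul_le_mul_of_nonneg_left hI (inv_nonneg.2 hw.le)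
    _ = B := by field_simp

/-- **Green–Kubo inequality in the shape of the item** (every `N`, `w > 0`):
`(N+1)·∫ Ȳ² dλ ≤ 2 · (N+1) · w⁻¹∫₀ʷ |E_λ[Y · Y∘Φ_u]| du`. [folklore] -/
theorem succ_mul_lintegral_windowAvg_sq_le_corr (ha : 0 < a₀) (hθ : 0 < θ₀) (hσ : σ ≤ 1 / 2) (N : ℕ)
    (Φ : HardSphereFlow (Torus.geometry (Fin 3)) (hsDiameter σ N) (N + 1))
    {φ : T3 → ℝ} (hφ : Continuous φ) {K : ℝ} (hφK : ∀ y, |φ y| ≤ K) {w : ℝ} (hw : 0 < w) :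
    ((N : ℝ≥0∞) + 1) * ∫⁻ z, ENNReal.ofReal ((((N : ℝ) + 1)⁻¹ * ∑ i : Fin (N + 1), w⁻¹ *
        ∫ r in (0 : ℝ)..w, φ (Φ.flow r z i).1 * ((Φ.flow r z i).2 0 * ‖(Φ.flow r z i).2‖ ^ 2 - 5 * θ₀ * (Φ.flow r z i).2 0)) ^ 2)
        ∂(localGibbsLaw σ (fun _ => a₀) (fun _ => 0) (fun _ => θ₀) N Φ) ≤
      2 * (((N : ℝ≥0∞) + 1) * ENNReal.ofReal (w⁻¹ * ∫ u in (0 : ℝ)..w, |∫ z, 𝐘[N, θ₀, φ, z] * 𝐘[N, θ₀, φ, Φ.flow u z]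
        ∂(localGibbsLaw σ (fun _ => a₀) (fun _ => 0) (fun _ => θ₀) N Φ)|)) := by
  haveI : IsProbabilityMeasure (localGibbsLaw σ (fun _ => a₀) (fun _ => (0 : V3)) (fun _ => θ₀) N Φ) :=
    isProbabilityMeasure_localGibbsLaw continuous_const continuous_const continuous_const
      (fun _ => ha) (fun _ => hθ) hσ N Φ
  set G := localGibbsLaw σ (fun _ => a₀) (fun _ => (0 : V3)) (fun _ => θ₀) N Φ with hGdef
  set A : Config (N + 1) (Fin 3) T3 → ℝ := fun z => w⁻¹ * ∫ r in (0 : ℝ)..w, 𝐘[N, θ₀, φ, Φ.flow r z] with hAdef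
  have hAi : Integrable A G :=
    (integrable_window a₀ θ₀ 0 Φ (measurable_Yobs θ₀ hφ) (integrable_Yobs ha hθ hσ N Φ hφ hφK) hw.le).const_mul _
  have hA2 : Integrable (fun z => A z ^ 2) G := by
    refine ((integrable_window a₀ θ₀ 0 Φ ((measurable_Yobs θ₀ hφ).pow_const 2)
      (integrable_Yobs_sq ha hθ hσ N Φ hφ hφK) hw.le).const_mul w⁻¹).mono' (hAi.aestronglyMeasurable.pow 2) ?_
    filter_upwards [ae_windowAvg_sq_le ha hθ hσ N Φ hφ hφK hw] with z hz
    rw [Real.norm_eq_abs, abs_of_nonneg (sq_nonneg _)]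
    exact hz
  have hae : (fun z => ENNReal.ofReal ((((N : ℝ) + 1)⁻¹ * ∑ i : Fin (N + 1), w⁻¹ *
        ∫ r in (0 : ℝ)..w, φ (Φ.flow r z i).1 * ((Φ.flow r z i).2 0 * ‖(Φ.flow r z i).2‖ ^ 2 - 5 * θ₀ * (Φ.flow r z i).2 0)) ^ 2)) =ᵐ[G]
      fun z => ENNReal.ofReal (A z ^ 2) := by
    filter_upwards [ae_windowSum_eq ha hθ hσ N Φ hφ hφK hw.le] with z hz
    have e : (((N : ℝ) + 1)⁻¹ * ∑ i : Fin (N + 1), w⁻¹ *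
        ∫ r in (0 : ℝ)..w, φ (Φ.flow r z i).1 * ((Φ.flow r z i).2 0 * ‖(Φ.flow r z i).2‖ ^ 2 - 5 * θ₀ * (Φ.flow r z i).2 0)) = A z := hz
    rw [e]
  have hpos : (0 : ℝ) ≤ w⁻¹ * ∫ u in (0 : ℝ)..w, |∫ z, 𝐘[N, θ₀, φ, z] * 𝐘[N, θ₀, φ, Φ.flow u z] ∂G| :=
    mul_nonneg (inv_nonneg.2 hw.le) (intervalIntegral.integral_nonneg hw.le fun u _ => abs_nonneg _)
  have hstep : ∫⁻ z, ENNReal.ofReal (A z ^ 2) ∂G ≤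
      2 * ENNReal.ofReal (w⁻¹ * ∫ u in (0 : ℝ)..w, |∫ z, 𝐘[N, θ₀, φ, z] * 𝐘[N, θ₀, φ, Φ.flow u z] ∂G|) := by
    have h := integral_windowAvg_sq_le_corr ha hθ hσ N Φ hφ hφK hw
    rw [mul_assoc] at h
    calc ∫⁻ z, ENNReal.ofReal (A z ^ 2) ∂G = ENNReal.ofReal (∫ z, A z ^ 2 ∂G) :=
          (ofReal_integral_eq_lintegral_ofReal hA2 (Eventually.of_forall fun z => sq_nonneg _)).symm
      _ ≤ ENNReal.ofReal (2 * (w⁻¹ * ∫ u in (0 : ℝ)..w, |∫ z, 𝐘[N, θ₀, φ, z] * 𝐘[N, θ₀, φ, Φ.flow u z] ∂G|)) :=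
          ENNReal.ofReal_le_ofReal h
      _ = 2 * ENNReal.ofReal (w⁻¹ * ∫ u in (0 : ℝ)..w, |∫ z, 𝐘[N, θ₀, φ, z] * 𝐘[N, θ₀, φ, Φ.flow u z] ∂G|) := by
          rw [ENNReal.ofReal_mul zero_le_two, ENNReal.ofReal_ofNat]
  rw [lintegral_congr_ae hae]
  calc ((N : ℝ≥0∞) + 1) * ∫⁻ z, ENNReal.ofReal (A z ^ 2) ∂G
      ≤ ((N : ℝ≥0∞) + 1) * (2 * ENNReal.ofReal (w⁻¹ * ∫ u in (0 : ℝ)..w, |∫ z, 𝐘[N, θ₀, φ, z] * 𝐘[N, θ₀, φ, Φ.flow u z] ∂G|)) :=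
        mul_le_mul_right hstep _
    _ = _ := by ring

/-! ## The reduction of the item to N-uniform Cesàro decay of the heat-flux autocorrelation -/

/-- **`EquilibriumHeatFluxVarianceDecay` FOLLOWS FROM THE GREEN–KUBO-TYPE DECAY OF THE EQUILIBRIUM HEAT-FLUX
AUTOCORRELATION.** Hypothesis (the open physical input, in kinetic time units, uniformly in `N`): for all `a₀, θ₀ > 0`
there is `σ₀ > 0` such that for `0 < σ < σ₀`, every flow family and every continuous `φ`,
`lim_{τ→∞} limsup_N (N+1) · w_N⁻¹ ∫₀^{w_N} |E_{λ^N}[Y · Y∘Φ^N_u]| du = 0`, `w_N = τ (N+1)^{-1/3}`,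
`Y = (N+1)⁻¹ Σᵢ φ(xᵢ) h_θ₀(vᵢ)` — i.e. the absolute autocorrelation of the per-particle fast kinetic heat flux is
Cesàro-null on kinetic times, uniformly in `N`, at every fixed small density. Conclusion: the route item, via the
Green–Kubo inequality `(N+1)E[Ȳ_τ²] ≤ 2(N+1)w_N⁻¹∫₀^{w_N}|C_N|` (stationarity of two-time correlations, Fubini,
`∫₀ʷ|C(|s−r|)|dr ≤ 2∫₀ʷ|C|`). [folklore] -/
theorem equilibriumHeatFluxVarianceDecay_of_cesaro_corr_decay
    (H : ∀ (a₀ θ₀ : ℝ), 0 < a₀ → 0 < θ₀ → ∃ σ₀ : ℝ, 0 < σ₀ ∧ ∀ σ : ℝ, 0 < σ → σ < σ₀ →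
      ∀ Φ : (N : ℕ) → HardSphereFlow (Torus.geometry (Fin 3)) (hsDiameter σ N) (N + 1),
      ∀ φ : T3 → ℝ, Continuous φ →
        Tendsto (fun τ : ℝ => Filter.limsup (fun N : ℕ => ((N : ℝ≥0∞) + 1) *
          ENNReal.ofReal ((τ * ((N : ℝ) + 1) ^ (-(1 / 3 : ℝ)))⁻¹ *
            ∫ u in (0 : ℝ)..(τ * ((N : ℝ) + 1) ^ (-(1 / 3 : ℝ))),
              |∫ z, 𝐘[N, θ₀, φ, z] * 𝐘[N, θ₀, φ, (Φ N).flow u z]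
                ∂(localGibbsLaw σ (fun _ => a₀) (fun _ => 0) (fun _ => θ₀) N (Φ N))|)) atTop) atTop (𝓝 0)) :
    Summit.AtomisticToContinuum.HydrodynamicLimit.Theses.OneFlightGossipEngine.EquilibriumHeatFluxVarianceDecay := by
  intro a₀ θ₀ ha hθ
  obtain ⟨σ₀, hσ₀, hH⟩ := H a₀ θ₀ ha hθ
  refine ⟨min σ₀ (1 / 2), lt_min hσ₀ (by norm_num), fun σ hσ hσlt Φ φ hφ => ?_⟩
  have hσ₀' : σ < σ₀ := lt_of_lt_of_le hσlt (min_le_left _ _)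
  have hσhalf : σ ≤ 1 / 2 := (lt_of_lt_of_le hσlt (min_le_right _ _)).le
  obtain ⟨K, -, hK⟩ := exists_forall_abs_le_of_continuous hφ
  have hD := hH σ hσ hσ₀' Φ φ hφ
  -- notation: `V τ` = the item's limsup, `D τ` = the hypothesis' limsup
  set D : ℝ → ℝ≥0∞ := fun τ => Filter.limsup (fun N : ℕ => ((N : ℝ≥0∞) + 1) *
    ENNReal.ofReal ((τ * ((N : ℝ) + 1) ^ (-(1 / 3 : ℝ)))⁻¹ *
      ∫ u in (0 : ℝ)..(τ * ((N : ℝ) + 1) ^ (-(1 / 3 : ℝ))),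
        |∫ z, 𝐘[N, θ₀, φ, z] * 𝐘[N, θ₀, φ, (Φ N).flow u z]
          ∂(localGibbsLaw σ (fun _ => a₀) (fun _ => 0) (fun _ => θ₀) N (Φ N))|)) atTop with hDdef
  have h2D : Tendsto (fun τ => 2 * D τ) atTop (𝓝 0) := by
    have h := ENNReal.Tendsto.const_mul hD (Or.inr ENNReal.ofNat_ne_top) (a := 2)
    rwa [mul_zero] at h
  refine tendsto_of_tendsto_of_tendsto_of_le_of_le' tendsto_const_nhds h2D
    (Eventually.of_forall fun τ => zero_le) ?_
  filter_upwards [eventually_gt_atTop (0 : ℝ)] with τ hτ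
  rw [hDdef, ← ENNReal.limsup_const_mul_of_ne_top ENNReal.ofNat_ne_top]
  refine limsup_le_limsup (Eventually.of_forall fun N => ?_)
  exact succ_mul_lintegral_windowAvg_sq_le_corr ha hθ hσhalf N (Φ N) hφ hK (window_pos hτ N)

end GreenKubo

end OneFlightGossipEngineHeatFlux

end Summit.AtomisticToContinuum.HydrodynamicLimit.Theorems

end
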